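import Literature.Analysis.FluidPDE.NovackScalingLaws
import HarnessLib

/-!
# Novack's ball-averaged energy balance at scale `ℓ` (Novack 2024, Thm. 1, line `• = I`)

Topic: Analysis/FluidPDE, the decomposition of the `4/3`-law half of the named fact
`Torus.novack2024_fourThirds_fourFifths` (`Literature.Analysis.FluidPDE.NovackScalingLaws`;
M. Novack, *Scaling laws and exact results in turbulence*, Nonlinearity 37 (2024) 095002, Thm. 1)
along the printed proof (op. cit. §2, Step 1).

## The printed proof of the line `• = I` (§2, Step 1) and what is recorded here

Novack tests the weak formulation with the ball-mollified velocity (Step 0) and obtains, for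
every scale `ℓ > 0` and after the limit `γ → 0` in which his radial kernels `η_{ℓ,γ}` tend to the
normalised indicator of the ball `B_ℓ`, the **scale-`ℓ` balance** (his (eq:main:balance) with
the ball kernel, `D_{I,ℓ,0}[u] = −(d/(4ℓ)) ⨍_{S^{d-1}} y·δu |δu|²(ℓy) dy`): in `𝒟'`,
`∂ₜ(u·u^ℓ) + ∂ⱼ(uʲ u·u^ℓ + ½((uʲ|u|²)^ℓ − uʲ (|u|²)^ℓ)) + ∂ᵢ(p u^{ℓ,i} + p^ℓ uⁱ) = −2 D_{I,ℓ,0}[u]`,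
where `f^ℓ(x) = ⨍_{B_ℓ} f(x + y) dy` is the ball average (`Torus.ballAvg`). Tested with `ψ`
supported in `(0,T) × T^d` (so that the datum/endpoint and — here — forcing and viscous terms are
absent) and multiplied by `2`, this is the identity `Torus.novack2024_ballAvg_balance`:
`𝒩_ℓ(ψ) = −(d/ℓ) ∫₀ᵀ∫ ⨍ (δu·ω)|δu|²(ℓω) dω ψ`, with **Novack's scale-`ℓ` pairing**
`𝒩_ℓ(ψ) = 2∫∫⟪u,u^ℓ⟫∂ₜψ + 2∫∫⟪u,u^ℓ⟫⟪u,∇ψ⟫ + ∫∫⟪(|u|²u)^ℓ,∇ψ⟫ − ∫∫(|u|²)^ℓ⟪u,∇ψ⟫ + 2∫∫p⟪u^ℓ,∇ψ⟫ + 2∫∫p^ℓ⟪u,∇ψ⟫`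
(`Torus.novackBallPairing`). He then lets `ℓ → 0`: "the left-hand side of (eq:main:balance)
converges in the sense of distributions as `ℓ → 0` to the left-hand side of
(eq:main:balance:thm)" [the balance of Thm. 1]) — recorded as
`Torus.novack2024_ballAvg_balance_tendsto`:
`𝒩_ℓ(ψ) → ∫∫ (2|u|²∂ₜψ + 2|u|²⟪u,∇ψ⟫ + 4p⟪u,∇ψ⟫)` (ball averages converge in `Lᵖ`,
`1 ≤ p < ∞`). From the two facts and the local energy balance
(`HasLocalEnergyBalance T 0 u p G D`: `∫∫ ½|u|²∂ₜψ + (½|u|²+p)⟪u,∇ψ⟫ = D ψ`) the **local 4/3 law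
follows and is proved here**: `Torus.hasFourThirdsLaw_of_ballAvg_balance`
(`ℓ⁻¹ ∫∫ ⨍ δ_L u|δu|² ψ = −d⁻¹ 𝒩_ℓ(ψ) → −d⁻¹ · 4 D ψ = −(4/d) D ψ`).

## Design notes

* Equation labels `(eq:main:balance)`, `(last:one)`, `(increments)`, … are the `\label`s of the
  arXiv source (arXiv:2310.01375v2, the held text), quoted verbatim because the held copy does not
  carry the printed equation numbers.
* Ball averages are taken over `B_ℓ ⊂ ℝ^d` acting through the covering map
  (`u (x + proj y)`), the convention of `Torus.increment`; Mathlib's set average `⨍ y in B_ℓ`.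
  Novack's `u_{I,ℓ,0} = ∫ u(x+y) η_{ℓ,0}(y) dy` with `η_{ℓ,0} = |B_ℓ|⁻¹ 1_{B_ℓ}` is `ballAvg u ℓ`.
* The facts carry the full hypothesis block of Thm. 1 (`d ≥ 2`, Novack weak solution with
  `u ∈ L³ ∩ C⁰_t L²_x`, `p ∈ L^{3/2}`, `u₀ ∈ L²`), exactly as `novack2024_fourThirds_fourFifths`;
  the scale is restricted to `0 < ℓ < 1/2` (the ball then embeds in a fundamental domain; only
  `ℓ → 0⁺` is used).
* **Sign disclosure.** The source's intermediate displays of Step 1 print the two pressure terms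
  with opposite signs (`∂ᵢφ uⁱ(x+y) p(x) − ∂ᵢφ uⁱ(x) p(x+y)`); the final balance (eq:main:balance)
  has `∂ⁱ(p u^ℓ_i + p^ℓ u_i)`, both with the same sign, which is what a direct computation for
  smooth solutions gives (`∂ₜ⟪u,u^ℓ⟫ = −⟪∇p,u^ℓ⟫ − ⟪u,∇p^ℓ⟫ − …`, `div u^ℓ = 0`) and what is
  vendored. The overall sign/factor bookkeeping (`×2`, `−d/ℓ = −|∂B_ℓ|/(ℓ… )`, i.e.
  `∇1_{B_ℓ} = −n σ_{∂B_ℓ}` and `|∂B_ℓ|/|B_ℓ| = d/ℓ`) was re-derived independently; as `ℓ → 0`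
  the identity is consistent with `D_{DR} = D_{balance}` (`4 D_ε → 4 D`); and the identity
  `𝒩_ℓ(ψ) = −(d/ℓ)∫∫⨍(δu·ω)|δu|²ψ` was checked numerically (to `10⁻¹⁴` relative, all six terms of
  `𝒩_ℓ` being of order one) on the exact time-dependent Euler solution
  `u = U(x − ct) + c`, `p = P(x − ct)` on `T²` (`U` the Taylor–Green field), scales
  `ℓ = 0.18, 0.31`, before being stated.
* Not vendored here: the line `• = L` (tensor kernel, §2 Step 2) and the assembly of
  `novack2024_fourThirds_fourFifths`; they live in a sibling file.

## References

* M. Novack, *Scaling laws and exact results in turbulence*, Nonlinearity 37 (2024) 095002,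
  arXiv:2310.01375: §2 Step 0 (test function computations), Step 1 (`• = I`: (eq:main:balance),
  the kernel limit `γ → 0`, `D_{I,ℓ,0}`, and the limit `ℓ → 0`). [Novack2024]
* J. Duchon, R. Robert, Nonlinearity 13 (2000) 249–255, proof of Prop. 1 (the mollified balance
  for smooth kernels). [DuchonRobert2000]
* G. B. Folland, *Real Analysis*, 2nd ed., Thm. 8.14 (a) (`f ⋆ φ_t → (∫φ) f` in `Lᵖ`). [Folland2020]
-/

noncomputable section

open MeasureTheory TopologicalSpace Set Function Filter Metric
open _root_.Topology
open scoped InnerProductSpace RealInnerProductSpace ENNReal NNReal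

namespace Literature.Analysis.FluidPDE.Torus

variable {d : Type*} [Fintype d]

/-! ## Ball averages through the covering map -/

section BallAvg

variable {F : Type*} [NormedAddCommGroup F] [NormedSpace ℝ F]

/-- The **ball average at scale `ℓ`** of a field on `T^d`,
`f^ℓ(x) = ⨍_{B_ℓ(0)} f(x + y) dy`, the separation `y ∈ ℝ^d` acting through the covering map
(Novack 2024, §2, the mollifications (increments) with the kernel `η_{ℓ,0} = |B_ℓ|⁻¹ 1_{B_ℓ}`:
"when `γ = 0` … convolution with `η_{ℓ,γ}` induces a weighted integral over the ball of radius
`ℓ`"). Mathlib's set average (junk `0` for `ℓ ≤ 0`, where the ball is empty, and off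
integrability). [cite: Novack2024, Sect. 2, kernels η_{ℓ,γ} and (increments) with γ = 0] -/
def ballAvg (f : UnitAddTorus d → F) (ℓ : ℝ) (x : UnitAddTorus d) : F :=
  ⨍ y in ball (0 : EuclideanSpace ℝ d) ℓ, f (x + FunctionSpaces.Torus.proj y)

/-- Unfolding the ball average. [folklore] -/
theorem ballAvg_apply (f : UnitAddTorus d → F) (ℓ : ℝ) (x : UnitAddTorus d) :
    ballAvg f ℓ x = ⨍ y in ball (0 : EuclideanSpace ℝ d) ℓ, f (x + FunctionSpaces.Torus.proj y) :=
  rfl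

/-- The ball average of the zero field vanishes. [folklore] -/
@[simp]
theorem ballAvg_zero (ℓ : ℝ) : ballAvg (0 : UnitAddTorus d → F) ℓ = 0 := by
  funext x
  simp [ballAvg]

/-- The ball average of a constant field is the constant (for `ℓ > 0`). [folklore] -/
theorem ballAvg_const [CompleteSpace F] [Nonempty d] (c : F) {ℓ : ℝ} (hℓ : 0 < ℓ) :
    ballAvg (fun _ : UnitAddTorus d => c) ℓ = fun _ => c := by
  funext x
  exact setAverage_const (measure_ball_pos volume _ hℓ).ne' measure_ball_lt_top.ne c

end BallAvg

/-! ## Novack's scale-`ℓ` pairing and the two named facts -/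

section Facts

/-- **Novack's scale-`ℓ` energy pairing** `𝒩_ℓ(ψ)`: twice the left-hand side of the scale-`ℓ`
balance (Novack 2024, §2 Step 1, (eq:main:balance) with the ball kernel, `ν = 0`, `f = 0`)
tested against a scalar `ψ` supported in `(0,T) × T^d`,
`𝒩_ℓ(ψ) = 2∫₀ᵀ∫ ⟪u, u^ℓ⟫ ∂ₜψ + 2∫₀ᵀ∫ ⟪u, u^ℓ⟫ ⟪u, ∇ψ⟫ + ∫₀ᵀ∫ ⟪(|u|²u)^ℓ, ∇ψ⟫ − ∫₀ᵀ∫ (|u|²)^ℓ ⟪u, ∇ψ⟫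
  + 2∫₀ᵀ∫ p ⟪u^ℓ, ∇ψ⟫ + 2∫₀ᵀ∫ p^ℓ ⟪u, ∇ψ⟫`
(`f^ℓ = ballAvg f ℓ`; the terms `∂ₜ(u·u^ℓ)`, `∂ⱼ(uʲ u·u^ℓ + ½((uʲ|u|²)^ℓ − uʲ(|u|²)^ℓ))`,
`∂ⁱ(p u^ℓᵢ + p^ℓ uᵢ)` of the source moved onto `ψ`). Bochner integrals (honest for `u ∈ L³`,
`p ∈ L^{3/2}`). [cite: Novack2024, Sect. 2 Step 1 (eq:main:balance)] -/
def novackBallPairing (T : ℝ) (u : ℝ → UnitAddTorus d → EuclideanSpace ℝ d)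
    (p : ℝ → UnitAddTorus d → ℝ) (ψ : ℝ → UnitAddTorus d → ℝ) (ℓ : ℝ) : ℝ :=
  2 * (∫ t in Ioo 0 T, ∫ x, ⟪u t x, ballAvg (u t) ℓ x⟫ * FunctionSpaces.Torus.timeDeriv ψ t x) +
    2 * (∫ t in Ioo 0 T, ∫ x,
      ⟪u t x, ballAvg (u t) ℓ x⟫ * ⟪u t x, FunctionSpaces.Torus.gradient (ψ t) x⟫) +
    (∫ t in Ioo 0 T, ∫ x,
      ⟪ballAvg (fun y => ‖u t y‖ ^ 2 • u t y) ℓ x, FunctionSpaces.Torus.gradient (ψ t) x⟫) -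
    (∫ t in Ioo 0 T, ∫ x,
      ballAvg (fun y => ‖u t y‖ ^ 2) ℓ x * ⟪u t x, FunctionSpaces.Torus.gradient (ψ t) x⟫) +
    2 * (∫ t in Ioo 0 T, ∫ x, p t x * ⟪ballAvg (u t) ℓ x, FunctionSpaces.Torus.gradient (ψ t) x⟫) +
    2 * (∫ t in Ioo 0 T, ∫ x, ballAvg (p t) ℓ x * ⟪u t x, FunctionSpaces.Torus.gradient (ψ t) x⟫)

/-- **Novack 2024, §2 Step 1: the scale-`ℓ` energy balance with the ball kernel** (the balance
(eq:main:balance) for `γ = 0`, where `D_{I,ℓ,0}[u] = −(d/(4ℓ)) ⨍_{S^{d−1}} y·δu |δu|²(ℓy) dy`;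
Euler case `ν = 0`, unforced). Under the hypotheses of Thm. 1 — `d ≥ 2`, `(u, p)` a weak
solution in Novack's sense on `[0,T] × T^d` with `u ∈ L³ ∩ C⁰([0,T]; L²)`, `p ∈ L^{3/2}`,
`u₀ ∈ L²` — for every scale `0 < ℓ < 1/2` and every test function `ψ` supported in
`(0,T) × T^d`:
`𝒩_ℓ(ψ) = 4 ∫₀ᵀ∫ D_{I,ℓ,0}[u] ψ = −(d/ℓ) ∫₀ᵀ∫ ⨍_{S^{d−1}} (δu(t,x;ℓω)·ω) |δu(t,x;ℓω)|² dω ψ(t,x) dx dt`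
(`Torus.novackBallPairing`, `Torus.energyFluxSphereAvg`). Printed proof: the mollified balance for
the smooth radial kernels `η_{ℓ,γ}` (Step 0 and Step 1 up to (last:one), the Duchon–Robert
computation) and the limit `γ → 0` (dominated convergence; Appendix, Prop. 1). [cite: Novack2024, Sect. 2 Step 1 (eq:main:balance) with γ = 0] -/
def novack2024_ballAvg_balance : Prop :=
  ∀ [DecidableEq d] {T : ℝ} {u₀ : UnitAddTorus d → EuclideanSpace ℝ d}
    {u : ℝ → UnitAddTorus d → EuclideanSpace ℝ d} {p : ℝ → UnitAddTorus d → ℝ},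
    2 ≤ Fintype.card d → 0 < T → IsWeakEulerSolutionWithPressureOn T 0 u₀ u p →
    ContinuousInLpOn (Icc 0 T) 2 u → (∫⁻ t in Ioo 0 T, ∫⁻ x, ‖u t x‖ₑ ^ (3 : ℕ) < ∞) →
    (∫⁻ t in Ioo 0 T, ∫⁻ x, ‖p t x‖ₑ ^ (3 / 2 : ℝ) < ∞) → MemLp u₀ 2 volume →
    ∀ {ℓ : ℝ}, 0 < ℓ → ℓ < 1 / 2 →
    ∀ {ψ : ℝ → UnitAddTorus d → ℝ}, FunctionSpaces.Torus.IsSpaceTimeTestIoo T ψ →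
      novackBallPairing T u p ψ ℓ =
        -((Fintype.card d : ℝ) / ℓ) * ∫ t in Ioo 0 T, ∫ x, energyFluxSphereAvg (u t) ℓ x * ψ t x

/-- **Novack 2024, §2 Step 1: the limit `ℓ → 0` of the scale-`ℓ` balance** ("the left-hand side
of (eq:main:balance) converges in the sense of distributions as `ℓ → 0` to the left-hand side of
(eq:main:balance:thm)"; ball averages converge in `Lᵖ`, `1 ≤ p < ∞`, Folland, *Real Analysis*,
Thm. 8.14 (a)).
Under the hypotheses of Thm. 1, for every test function `ψ` supported in `(0,T) × T^d`,
`𝒩_ℓ(ψ) → ∫₀ᵀ∫ (2|u|² ∂ₜψ + 2|u|² ⟪u, ∇ψ⟫ + 4 p ⟪u, ∇ψ⟫)` as `ℓ → 0⁺`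
(twice the pairing of `∂ₜ|u|² + ∂ⱼ(uʲ|u|² + 2puʲ)` with `ψ`, moved onto `ψ`). [cite: Novack2024, Sect. 2 Step 1, limit ℓ → 0] -/
def novack2024_ballAvg_balance_tendsto : Prop :=
  ∀ [DecidableEq d] {T : ℝ} {u₀ : UnitAddTorus d → EuclideanSpace ℝ d}
    {u : ℝ → UnitAddTorus d → EuclideanSpace ℝ d} {p : ℝ → UnitAddTorus d → ℝ},
    2 ≤ Fintype.card d → 0 < T → IsWeakEulerSolutionWithPressureOn T 0 u₀ u p →
    ContinuousInLpOn (Icc 0 T) 2 u → (∫⁻ t in Ioo 0 T, ∫⁻ x, ‖u t x‖ₑ ^ (3 : ℕ) < ∞) →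
    (∫⁻ t in Ioo 0 T, ∫⁻ x, ‖p t x‖ₑ ^ (3 / 2 : ℝ) < ∞) → MemLp u₀ 2 volume →
    ∀ {ψ : ℝ → UnitAddTorus d → ℝ}, FunctionSpaces.Torus.IsSpaceTimeTestIoo T ψ →
      Tendsto (fun ℓ => novackBallPairing T u p ψ ℓ) (𝓝[>] 0)
        (𝓝 (∫ t in Ioo 0 T, ∫ x,
          (2 * (‖u t x‖ ^ 2 * FunctionSpaces.Torus.timeDeriv ψ t x) +
            2 * (‖u t x‖ ^ 2 * ⟪u t x, FunctionSpaces.Torus.gradient (ψ t) x⟫) +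
            4 * (p t x * ⟪u t x, FunctionSpaces.Torus.gradient (ψ t) x⟫))))

end Facts

/-! ## The local 4/3 law from the two facts -/

section Assembly

variable [DecidableEq d] {T : ℝ} {u : ℝ → UnitAddTorus d → EuclideanSpace ℝ d}
  {u₀ : UnitAddTorus d → EuclideanSpace ℝ d} {p : ℝ → UnitAddTorus d → ℝ}

/-- Twice the local energy balance, as one pairing: if `HasLocalEnergyBalance T 0 u p G D`, then
`∫₀ᵀ∫ (2|u|²∂ₜψ + 2|u|²⟪u,∇ψ⟫ + 4p⟪u,∇ψ⟫) = 4 D ψ` (Duchon–Robert 2000, (10), times four). [cite: DuchonRobert2000, (10)] -/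
theorem HasLocalEnergyBalance.integral_two_mul_eq
    {G : ℝ → UnitAddTorus d → EuclideanSpace ℝ d →L[ℝ] EuclideanSpace ℝ d} {D : STFunctional d}
    (hbal : HasLocalEnergyBalance T 0 u p G D) {ψ : ℝ → UnitAddTorus d → ℝ}
    (hψ : FunctionSpaces.Torus.IsSpaceTimeTestIoo T ψ) :
    ∫ t in Ioo 0 T, ∫ x,
        (2 * (‖u t x‖ ^ 2 * FunctionSpaces.Torus.timeDeriv ψ t x) +
          2 * (‖u t x‖ ^ 2 * ⟪u t x, FunctionSpaces.Torus.gradient (ψ t) x⟫) +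
          4 * (p t x * ⟪u t x, FunctionSpaces.Torus.gradient (ψ t) x⟫)) = 4 * D ψ := by
  rw [← hbal.2 ψ hψ, ← integral_const_mul]
  refine integral_congr_ae (ae_of_all _ fun t => ?_)
  simp only
  rw [← integral_const_mul]
  refine integral_congr_ae (ae_of_all _ fun x => ?_)
  simp only
  ring

/-- **The local 4/3 law from Novack's scale-`ℓ` balance** (Novack 2024, Thm. 1, line `• = I`,
assembled as in §2 Step 1): granted `novack2024_ballAvg_balance` and
`novack2024_ballAvg_balance_tendsto`, under the hypotheses of Thm. 1 every `D` with the local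
energy balance `HasLocalEnergyBalance T 0 u p G D` satisfies `HasFourThirdsLaw T u D`:
for `0 < ℓ < 1/2`, `∫∫ ℓ⁻¹ ⨍ δ_L u |δu|² ψ = −d⁻¹ 𝒩_ℓ(ψ) → −d⁻¹ · 4 D ψ = −(4/d) D ψ`. [cite: Novack2024, Thm. 1] -/
theorem hasFourThirdsLaw_of_ballAvg_balance (hB : novack2024_ballAvg_balance (d := d))
    (hL : novack2024_ballAvg_balance_tendsto (d := d)) (hd : 2 ≤ Fintype.card d) (hT : 0 < T)
    (hsol : IsWeakEulerSolutionWithPressureOn T 0 u₀ u p) (hC : ContinuousInLpOn (Icc 0 T) 2 u)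
    (hu3 : ∫⁻ t in Ioo 0 T, ∫⁻ x, ‖u t x‖ₑ ^ (3 : ℕ) < ∞)
    (hp : ∫⁻ t in Ioo 0 T, ∫⁻ x, ‖p t x‖ₑ ^ (3 / 2 : ℝ) < ∞) (hu₀ : MemLp u₀ 2 volume)
    {G : ℝ → UnitAddTorus d → EuclideanSpace ℝ d →L[ℝ] EuclideanSpace ℝ d} {D : STFunctional d}
    (hbal : HasLocalEnergyBalance T 0 u p G D) : HasFourThirdsLaw T u D := by
  intro ψ hψ
  have hd0 : (Fintype.card d : ℝ) ≠ 0 := by exact_mod_cast (show Fintype.card d ≠ 0 by omega)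
  -- the eventual identity `ℓ⁻¹ ∫∫ ⨍ δ_L u|δu|² ψ = −d⁻¹ 𝒩_ℓ(ψ)` on `(0, 1/2)`
  have hev : ∀ᶠ ℓ in 𝓝[>] (0 : ℝ), -(Fintype.card d : ℝ)⁻¹ * novackBallPairing T u p ψ ℓ =
      ∫ t in Ioo 0 T, ∫ x, ℓ⁻¹ * energyFluxSphereAvg (u t) ℓ x * ψ t x := by
    filter_upwards [Ioo_mem_nhdsGT (show (0 : ℝ) < 1 / 2 by norm_num)] with ℓ hℓ
    have hℓ0 : ℓ ≠ 0 := hℓ.1.ne'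
    rw [hB hd hT hsol hC hu3 hp hu₀ hℓ.1 hℓ.2 hψ]
    have hpull : ∫ t in Ioo 0 T, ∫ x, ℓ⁻¹ * energyFluxSphereAvg (u t) ℓ x * ψ t x =
        ℓ⁻¹ * ∫ t in Ioo 0 T, ∫ x, energyFluxSphereAvg (u t) ℓ x * ψ t x := by
      rw [← integral_const_mul]
      refine integral_congr_ae (ae_of_all _ fun t => ?_)
      simp only
      rw [← integral_const_mul]
      refine integral_congr_ae (ae_of_all _ fun x => ?_)
      simp only
      ring
    rw [hpull]
    field_simp
  -- the limit `−d⁻¹ 𝒩_ℓ(ψ) → −d⁻¹ · 4 D ψ = −(4/d) D ψ`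
  have hlim := (hL hd hT hsol hC hu3 hp hu₀ hψ).const_mul (-(Fintype.card d : ℝ)⁻¹)
  rw [hbal.integral_two_mul_eq hψ] at hlim
  have hconst : -(Fintype.card d : ℝ)⁻¹ * (4 * D ψ) = -fourThirdsConst d * D ψ := by
    rw [fourThirdsConst]
    field_simp
  rw [hconst] at hlim
  exact hlim.congr' hev

end Assembly

end Literature.Analysis.FluidPDE.Torus
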